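import Summits.QuantumFields.YangMills.Theorems.BalabanLadderUVSeamRecResponseMomentsPinning
import HarnessLib

/-!
# Crux `UVSeamRec` (stmt-QuantumFields-20043), v5(α) stub `stub_responseMomentsOdd6` (RM): joint PRODUCT moments of the
# rescaled responses are what the collar consumes — a strictly WEAKER sufficient currency (PM), kernel-checked end-to-end

Helper file (`--supports stmt-QuantumFields-20043`) of the stub-helper seat `ym-20043-seam-s2` (lane S-A, gen 2).

LOCATED OBSERVATION.  The landed press-button chain of the v5(α) slot is (RM) ⇒ `MomentBounds6` (p532025
`TemperedResponse.momentBounds6_of_responseMoments` ⊕ p532738), whose engine p530862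
`TemperedResponse.abs_integral_prod_sub_mean_le_of_response` uses the joint EXPONENTIAL moments
`⟨exp(Σ_{i∈T} Yᵢ)⟩ ≤ e^{B·#T}` of the influence functionals ONLY through the pointwise step `∏ᵢ(1 + Yᵢ) ≤ exp(Σᵢ Yᵢ)`.
Hence the collar consumes exactly the joint PRODUCT moments

  (PM)  `⟨∏_{i∈T} (1 + (R⁴/C₁)·|kerE_{cube i}(plane_i)(lift ·) − p (q i) β|)⟩_{2L+1,β} ≤ exp(B·#T)`

(same guards as (RM): `β ≥ β₁`, odd torus `(ℤ/(2L+1))⁴`, `1 ≤ R`, `R·a β ≤ ℓ₁`, `4R+8 ≤ L`, cyclic `2R+4`-separation, every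
index set `T`).  (RM) ⇒ (PM) pointwise (`1 + y ≤ eʸ`), and (PM) is STRICTLY WEAKER in what it asks of ONE cube: at `T = {i}`
it is the FIRST moment `⟨(R⁴/C₁)|kerE − p|⟩ ≤ e^B − 1` — the AVERAGED one-point law — where (RM) asks for an exponential
tail `μ(R⁴|kerE − p|/C₁ > t) ≲ e^{B − t}`.  Across cubes (PM) asks for multiplicativity of these first-order sizes
(exact for independent responses, where (PM) needs ONLY the means), i.e. a decoupling property at scale `R`, instead of a
uniform large-deviation structure.  In the calibrations of record the two currencies differ exactly on the heavy-tail
side: a response event of μ-weight `e^{−o(R⁴)}` with `O(1)` centre response is fatal for (RM) and invisible to (PM).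

Contents (general `(G, r, a)`; nothing here changes the registered slot — (PM) is a candidate v6 currency for the owner's
pen, `stub_productMomentsOdd6 : UV → (PM)`, with the press-button below):

* §1 `abs_integral_prod_sub_mean_le_of_productResponse` — the collar engine p530862 VERBATIM with the exponential-moment
  hypothesis replaced by the product-moment hypothesis `∫ ∏_{i∈T}(1 + Yᵢ∘lift) ≤ e^{B·#T}`; same output
  `(ε(2 + e^B)e^B)ⁿ`.
* §2 `momentBounds6_of_productResponse` — response law (a′) + (PM′) for general carriers `Y` ⇒ `MomentBounds6 G r a`;
  **`momentBounds6_of_productMoments`** — (PM) alone ⇒ `MomentBounds6 G r a`, `C = C₁(2 + e^B)e^B` (carrier := the rescaled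
  response, law tautological, as in p532025).
* Sequel `…CeilingsProductMomentsUnit.lean`: `productMoments_of_responseMoments` ((RM) ⇒ (PM), so the v5(α) chain
  factors through (PM)) and the press-button `stubCeilings_of_productMoments` ((PM) at a unit `a ≤ c·uRec` eventually ⇒
  `MomentBounds6 (SU(2)) rF uRec`, the registered `stub_ceilings` conclusion VERBATIM — the (PM) twin of p532738).

HONEST FRAMING: consumption-side theorems for a CONDITIONAL chain; (PM) at `β → ∞`, like (RM), is an OPEN statement
about the lattice Yang–Mills measure (E0′-averaged + decoupling at scale `R`); nothing of it and nothing of E0′ is proved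
here; not a gap, not Clay.

References: H.-O. Georgii, *Gibbs Measures and Phase Transitions* (2011) Thm. 4.17 (the DLR step, via p518354's collar
identity); E. Seiler, LNP 159 (1982) Ch. 2.
-/

set_option autoImplicit false

noncomputable section

open MeasureTheory Filter Topology Finset
open Literature.Probability.LatticeModels
open Literature.MathematicalPhysics.QuantumFieldTheory (GaugeConfig wilsonMeasure isProbabilityMeasure_wilsonMeasure
  measurable_torusLift LatticeRep)
open Literature.MathematicalPhysics.QuantumLattice
open Summit.QuantumFields.YangMills.Cruxes.UVSeamRec.DefectCollar (integral_prod_sub_mean_eq_integral_prod_collared)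

namespace Summit.QuantumFields.YangMills.Cruxes.UVSeamRec.ProductMoments

/-! ## §1 The collar engine on joint PRODUCT moments (any dimension, any torus side) -/

section Engine

variable {d N : ℕ} {G : Type*} [Group G] [TopologicalSpace G] [IsTopologicalGroup G]
  [CompactSpace G] [MeasurableSpace G] [BorelSpace G] [SecondCountableTopology G]
  (ρ : G →* Matrix (Fin N) (Fin N) ℂ)

/-- **THE PRODUCT-RESPONSE COLLAR.**  In the geometry of the collar identity (bounded continuous cylinder observables
`Aᵢ` with supports `Sᵢ`, link sets `Λᵢ` injecting into the torus and far from each other's supports), suppose that for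
EVERY exterior `η` the kernel mean obeys `|γ_{Λᵢ}Aᵢ(η) − p| ≤ ε (1 + Yᵢ(η))` with measurable bounded influence functionals
`Yᵢ ≥ 0`, and that the torus state gives their joint PRODUCT moments the multiplicative bound
`∫ ∏_{i∈T} (1 + Yᵢ(lift V)) dμ ≤ exp(B·#T)` for every set `T` of members.  Then the centred `n`-th moment of the `Aᵢ` is
at most `(ε (2 + e^B) e^B)ⁿ`.  This is p530862's engine with its only use of the exponential moments — the pointwise step
`∏(1 + Yᵢ) ≤ exp(Σ Yᵢ)` — removed: `|hᵢ| ≤ ε(2 + e^B)(1 + Yᵢ)`, integrate the product directly. [folklore: Georgii (2011)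
Thm. 4.17 for the DLR part] -/
theorem abs_integral_prod_sub_mean_le_of_productResponse (hρ : Continuous ρ) (β : ℝ) {L : ℕ} [NeZero L] {n : ℕ}
    (Λ S : Fin n → Finset (ZdEdge d))
    (A : Fin n → LGConfig d G → ℝ) (hAc : ∀ i, Continuous (A i)) {CA : ℝ} (hAb : ∀ i U, |A i U| ≤ CA)
    (hAS : ∀ i, IsCylinder (A i) (S i))
    (hinj : ∀ i, Set.InjOn (Torus.proj L)
      ((Λ i ∪ S i ∪ (plaquettesTouching (Λ i)).biUnion plaquetteEdges).image Prod.fst : Set (Site d)))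
    (hfar : ∀ i j, i ≠ j → ∀ e ∈ S j ∪ (plaquettesTouching (Λ j)).biUnion plaquetteEdges, ∀ e' ∈ Λ i,
      torusEdge L e ≠ torusEdge L e')
    (m : Fin n → ℝ) (hm : ∀ i, m i = ∫ W, A i (torusLift L W) ∂(wilsonMeasure ρ β))
    (Y : Fin n → LGConfig d G → ℝ) (hYm : ∀ i, Measurable (Y i)) (hY0 : ∀ i η, 0 ≤ Y i η)
    {MY : ℝ} (hYb : ∀ i η, Y i η ≤ MY)
    {p ε B : ℝ} (hε : 0 ≤ ε)
    (hker : ∀ i η, |(∫ U, A i U ∂(ymSpecification ρ β (Λ i) η)) - p| ≤ ε * (1 + Y i η))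
    (hpm : ∀ T : Finset (Fin n),
      ∫ V, ∏ i ∈ T, (1 + Y i (torusLift L V)) ∂(wilsonMeasure ρ β) ≤ Real.exp (B * T.card)) :
    |∫ V, ∏ i, (A i (torusLift L V) - m i) ∂(wilsonMeasure ρ β)| ≤
      (ε * ((2 + Real.exp B) * Real.exp B)) ^ n := by
  classical
  haveI := isProbabilityMeasure_wilsonMeasure (d := d) (L := L) ρ hρ β
  rw [integral_prod_sub_mean_eq_integral_prod_collared ρ hρ β Λ S A hAc hAb hAS hinj hfar m]
  -- kernel means
  set g : Fin n → LGConfig d G → ℝ := fun i η => ∫ U, A i U ∂(ymSpecification ρ β (Λ i) η) with hgdef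
  have hgc : ∀ i, Continuous (g i) := fun i =>
    continuous_integral_ymSpecification ρ hρ β (Λ i) (hAc i) (hAb i)
  have hgb : ∀ i η, |g i η| ≤ CA := fun i η => abs_integral_ymSpecification_le ρ hρ β (Λ i) (hAb i) η
  have hgm : ∀ i, Measurable fun V : GaugeConfig d L G => g i (torusLift L V) := fun i =>
    ((hgc i).comp (continuous_torusLift L)).measurable
  -- the influence functionals read on the torus
  have hYlm : ∀ i, Measurable fun V : GaugeConfig d L G => Y i (torusLift L V) := fun i =>
    (hYm i).comp (measurable_torusLift L)
  have hYlb : ∀ i (V : GaugeConfig d L G), |Y i (torusLift L V)| ≤ MY := fun i V => by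
    rw [abs_of_nonneg (hY0 i _)]; exact hYb i _
  have hYli : ∀ i, Integrable (fun V : GaugeConfig d L G => Y i (torusLift L V)) (wilsonMeasure ρ β) :=
    fun i => integrable_of_abs_le (hYlm i) (hYlb i)
  have hprodm : ∀ T : Finset (Fin n), Measurable fun V : GaugeConfig d L G =>
      ∏ i ∈ T, (1 + Y i (torusLift L V)) := fun T =>
    Finset.measurable_prod T fun i _ => measurable_const.add (hYlm i)
  have hprodi : ∀ T : Finset (Fin n), Integrable (fun V : GaugeConfig d L G =>
      ∏ i ∈ T, (1 + Y i (torusLift L V))) (wilsonMeasure ρ β) := fun T => by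
    refine integrable_of_abs_le (hprodm T) (C := ∏ _i ∈ T, (1 + MY)) fun V => ?_
    rw [Finset.abs_prod]
    exact Finset.prod_le_prod (fun i _ => abs_nonneg _) fun i _ => by
      rw [abs_of_nonneg (by linarith [hY0 i (torusLift L V)])]
      linarith [hYb i (torusLift L V)]
  -- the mean influence is at most `e^B`
  have hEY : ∀ i, ∫ V, Y i (torusLift L V) ∂(wilsonMeasure ρ β) ≤ Real.exp B := by
    intro i
    have h2 := hpm {i}
    rw [Finset.card_singleton, Nat.cast_one, mul_one] at h2
    simp only [Finset.prod_singleton] at h2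
    rw [integral_add (integrable_const _) (hYli i), integral_const, smul_eq_mul, probReal_univ, one_mul] at h2
    linarith
  -- the degenerate case `n = 0`
  rcases Nat.eq_zero_or_pos n with hn | hn
  · subst hn
    simp
  -- the torus mean is the torus mean of the kernel mean (DLR step with trivial far factor)
  have hm' : ∀ i, m i = ∫ V, g i (torusLift L V) ∂(wilsonMeasure ρ β) := fun i => by
    have h1 := integral_torusLift_mul_eq_integral_ymSpecification_mul ρ hρ β (Λ i) (hAc i) (hAb i)
      (hAS i) (hinj i) (H := fun _ => (1 : ℝ)) measurable_const (D := 1) (fun _ => by simp)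
      (fun _ _ => rfl)
    rw [hm i]
    simpa [hgdef] using h1
  -- the torus means are within `ε (1 + e^B)` of `p`
  have hmp : ∀ i, |m i - p| ≤ ε * (1 + Real.exp B) := by
    intro i
    have e1 : m i - p = ∫ V, (g i (torusLift L V) - p) ∂(wilsonMeasure ρ β) := by
      rw [hm' i, integral_sub_const_of_abs_le (hgm i) (fun V => hgb i _) p]
    rw [e1]
    calc |∫ V, (g i (torusLift L V) - p) ∂(wilsonMeasure ρ β)|
        ≤ ∫ V, |g i (torusLift L V) - p| ∂(wilsonMeasure ρ β) := abs_integral_le_integral_abs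
      _ ≤ ∫ V, ε * (1 + Y i (torusLift L V)) ∂(wilsonMeasure ρ β) :=
          integral_mono_of_nonneg (ae_of_all _ fun V => abs_nonneg _)
            (((integrable_const (1 : ℝ)).add (hYli i)).const_mul ε) (ae_of_all _ fun V => hker i _)
      _ = ε * (1 + ∫ V, Y i (torusLift L V) ∂(wilsonMeasure ρ β)) := by
          rw [integral_const_mul, integral_add (integrable_const _) (hYli i), integral_const]
          simp
      _ ≤ ε * (1 + Real.exp B) := by gcongr; exact hEY i
  -- pointwise bound on the collared factors
  set K : ℝ := ε * (2 + Real.exp B) with hKdef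
  have hK : 0 ≤ K := by positivity
  have hh : ∀ i η, |g i η - m i| ≤ K * (1 + Y i η) := by
    intro i η
    have e1 : g i η - m i = (g i η - p) - (m i - p) := by ring
    rw [e1]
    have hY := hY0 i η
    have hB := Real.exp_nonneg B
    calc |(g i η - p) - (m i - p)| ≤ |g i η - p| + |m i - p| := abs_sub _ _
      _ ≤ ε * (1 + Y i η) + ε * (1 + Real.exp B) := add_le_add (hker i η) (hmp i)
      _ ≤ K * (1 + Y i η) := by
          rw [hKdef]
          nlinarith [mul_nonneg hε hY, mul_nonneg (mul_nonneg hε hB) hY]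
  -- the product of the collared factors is dominated by `K^n ∏ (1 + Yᵢ)` — no exponential step
  have hprod : ∀ V : GaugeConfig d L G, |∏ i, (g i (torusLift L V) - m i)| ≤
      K ^ n * ∏ i, (1 + Y i (torusLift L V)) := by
    intro V
    rw [Finset.abs_prod]
    calc ∏ i, |g i (torusLift L V) - m i| ≤ ∏ i, K * (1 + Y i (torusLift L V)) :=
          Finset.prod_le_prod (fun i _ => abs_nonneg _) fun i _ => hh i _
      _ = K ^ n * ∏ i, (1 + Y i (torusLift L V)) := by
          rw [Finset.prod_mul_distrib, Finset.prod_const, Finset.card_univ, Fintype.card_fin]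
  -- integrate
  have hpmU := hpm Finset.univ
  rw [Finset.card_univ, Fintype.card_fin] at hpmU
  calc |∫ V, ∏ i, (g i (torusLift L V) - m i) ∂(wilsonMeasure ρ β)|
      ≤ ∫ V, |∏ i, (g i (torusLift L V) - m i)| ∂(wilsonMeasure ρ β) := abs_integral_le_integral_abs
    _ ≤ ∫ V, K ^ n * ∏ i, (1 + Y i (torusLift L V)) ∂(wilsonMeasure ρ β) :=
        integral_mono_of_nonneg (ae_of_all _ fun V => abs_nonneg _) ((hprodi Finset.univ).const_mul _)
          (ae_of_all _ hprod)
    _ = K ^ n * ∫ V, ∏ i, (1 + Y i (torusLift L V)) ∂(wilsonMeasure ρ β) := integral_const_mul _ _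
    _ ≤ K ^ n * Real.exp (B * n) := mul_le_mul_of_nonneg_left hpmU (pow_nonneg hK _)
    _ = (ε * ((2 + Real.exp B) * Real.exp B)) ^ n := by
        rw [mul_comm B, Real.exp_nat_mul, ← mul_pow, hKdef]; ring

end Engine

/-! ## §2 `MomentBounds6` from joint product moments -/

section Route

open Summit.QuantumFields.YangMills.Cruxes.OSLegsFromFemtoAndGap.DlrCollarTransfer
open Summit.QuantumFields.YangMills.Cruxes.UVSeamRec.TemperedResponse (continuous_kerE_plane abs_kerE_plane_le)

variable {G : Type} [Group G] [TopologicalSpace G] [IsTopologicalGroup G] [CompactSpace G]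
  [MeasurableSpace G] [BorelSpace G] (r : LatticeRep G) (a : ℝ → ℝ)

/-- **`MomentBounds6 G r a` from a response law and β-uniform joint PRODUCT moments of the carriers — all odd sides.**
Data as in p530862 `momentBounds6_of_temperedResponse` (measurable bounded carriers `Y β R q x ≥ 0`, reference values
`|p q β| ≤ P₀`, `C₁ ≥ 0`, `B`, `ℓ₁ > 0`, `β₁`; (a′) `|kerE(plane q x)(η) − p q β| ≤ (C₁/R⁴)(1 + Y β R q x η)` for every
exterior), with (EM′) replaced by (PM′): on every odd torus, `4R+8 ≤ L`, for cyclically separated families and every `T`,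
`⟨∏_{i∈T}(1 + Y β R (q i) (x i)∘lift)⟩_{2L+1,β} ≤ exp(B·#T)`.  THEN `MomentBounds6 G r a` with `C = C₁ (2 + e^B) e^B`.
[folklore: Georgii (2011) Thm. 4.17 for the DLR part] -/
theorem momentBounds6_of_productResponse {C₁ B β₁ ℓ₁ P₀ : ℝ} {p : Fin 4 × Fin 4 → ℝ → ℝ}
    (Y : ℝ → ℕ → Fin 4 × Fin 4 → (Fin 4 → ℤ) → LGConfig 4 G → ℝ) (MY : ℝ → ℕ → ℝ)
    (hℓ₁ : 0 < ℓ₁) (hC₁ : 0 ≤ C₁) (hp : ∀ q β, |p q β| ≤ P₀)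
    (hYm : ∀ β R q x, Measurable (Y β R q x)) (hY0 : ∀ β R q x η, 0 ≤ Y β R q x η)
    (hYb : ∀ β R q x η, Y β R q x η ≤ MY β R)
    (hlaw : ∀ β : ℝ, β₁ ≤ β → ∀ R : ℕ, 1 ≤ R → (R : ℝ) * a β ≤ ℓ₁ →
      ∀ (q : Fin 4 × Fin 4) (x : Fin 4 → ℤ), q.1 < q.2 → ∀ η : LGConfig 4 G,
        |kerE G r β (fun k => x k - (R + 1)) (2 * R + 3) η (plane G r q x) - p q β| ≤
          C₁ / (R : ℝ) ^ 4 * (1 + Y β R q x η))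
    (hPM : ∀ β : ℝ, β₁ ≤ β → ∀ (L n : ℕ) (q : Fin n → Fin 4 × Fin 4) (x : Fin n → (Fin 4 → ℤ)) (R : ℕ),
      (∀ i, (q i).1 < (q i).2) → 1 ≤ R → (R : ℝ) * a β ≤ ℓ₁ → 4 * R + 8 ≤ L →
      (∀ i j : Fin n, i ≠ j → ∃ k : Fin 4,
        (2 * (R : ℤ) + 4) ≤ |((((x i k - x j k : ℤ) : ZMod (2 * L + 1))).valMinAbs : ℤ)|) →
      ∀ T : Finset (Fin n),
        torusE G r β L (fun U => ∏ i ∈ T, (1 + Y β R (q i) (x i) U)) ≤ Real.exp (B * T.card)) :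
    MomentBounds6 G r a := by
  haveI : SecondCountableTopology G :=
    (r.continuous.isClosedEmbedding r.injective).isEmbedding.secondCountableTopology
  obtain ⟨CA, hCA⟩ := exists_abs_plane_le r
  have hP₀ : 0 ≤ P₀ := (abs_nonneg _).trans (hp (0, 1) 0)
  refine ⟨C₁ * ((2 + Real.exp B) * Real.exp B), β₁, ℓ₁, hℓ₁, by positivity, ?_⟩
  intro β hβ L n q x R hq hR hRa hRL hsep
  haveI := isProbabilityMeasure_wilsonMeasure (d := 4) (L := 2 * L + 1) r.ρ r.continuous β
  have hR0 : (0 : ℝ) < (R : ℝ) ^ 4 := by positivity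
  have hmeas : ∀ i : Fin n, Measurable (plane G r (q i) (x i)) := fun i =>
    (continuous_plane r (q i) (x i)).measurable
  have hAc : ∀ i : Fin n, Continuous fun U => plane G r (q i) (x i) U - p (q i) β := fun i =>
    (continuous_plane r (q i) (x i)).sub continuous_const
  have hAb : ∀ (i : Fin n) (U : LGConfig 4 G), |plane G r (q i) (x i) U - p (q i) β| ≤ CA + P₀ :=
    fun i U => (abs_sub _ _).trans (add_le_add (hCA _ _ _) (hp _ _))
  have hAS : ∀ i : Fin n, IsCylinder (fun U => plane G r (q i) (x i) U - p (q i) β)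
      (cubeEdges (fun k => x i k - (R + 1)) (2 * R + 3)) :=
    fun i U V hUV => by simp only [isCylinder_plane_cube r hR (q i) (x i) hUV]
  have hinj : ∀ i : Fin n, Set.InjOn (Torus.proj (2 * L + 1))
      (((cubeEdges (fun k => x i k - (R + 1)) (2 * R + 3) ∪ cubeEdges (fun k => x i k - (R + 1)) (2 * R + 3) ∪
          (plaquettesTouching (cubeEdges (fun k => x i k - (R + 1)) (2 * R + 3))).biUnion plaquetteEdges).image
          Prod.fst : Set (Fin 4 → ℤ))) := fun i => injOn_torusProj_cube hRL (x i)
  have hfar : ∀ i j : Fin n, i ≠ j → ∀ e ∈ cubeEdges (fun k => x j k - (R + 1)) (2 * R + 3) ∪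
      (plaquettesTouching (cubeEdges (fun k => x j k - (R + 1)) (2 * R + 3))).biUnion plaquetteEdges,
      ∀ e' ∈ cubeEdges (fun k => x i k - (R + 1)) (2 * R + 3),
      torusEdge (2 * L + 1) e ≠ torusEdge (2 * L + 1) e' :=
    fun i j hij e he e' he' => torusEdge_ne_cube (hsep i j hij) he he'
  have hm : ∀ i : Fin n, torusE G r β L (plane G r (q i) (x i)) - p (q i) β =
      ∫ W, (plane G r (q i) (x i) (torusLift (2 * L + 1) W) - p (q i) β)
        ∂(wilsonMeasure (d := 4) (L := 2 * L + 1) r.ρ β) := fun i =>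
    (integral_sub_const_of_abs_le (μ := wilsonMeasure (d := 4) (L := 2 * L + 1) r.ρ β)
      ((continuous_plane r (q i) (x i)).comp (continuous_torusLift (2 * L + 1))).measurable
      (fun W => hCA (q i) (x i) (torusLift (2 * L + 1) W)) (p (q i) β)).symm
  have hker : ∀ (i : Fin n) (η : LGConfig 4 G),
      |(∫ U, (plane G r (q i) (x i) U - p (q i) β) ∂(ymSpecification r.ρ β
        (cubeEdges (fun k => x i k - (R + 1)) (2 * R + 3)) η)) - 0| ≤
        C₁ / (R : ℝ) ^ 4 * (1 + Y β R (q i) (x i) η) := fun i η => by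
    haveI := isProbabilityMeasure_ymSpecification r.ρ r.continuous β
      (cubeEdges (fun k => x i k - (R + 1)) (2 * R + 3)) η
    rw [sub_zero, integral_sub_const_of_abs_le (hmeas i) (fun U => hCA (q i) (x i) U) (p (q i) β)]
    exact hlaw β hβ R hR hRa (q i) (x i) (hq i) η
  have hpm : ∀ T : Finset (Fin n),
      ∫ V, ∏ i ∈ T, (1 + Y β R (q i) (x i) (torusLift (2 * L + 1) V))
        ∂(wilsonMeasure (d := 4) (L := 2 * L + 1) r.ρ β) ≤ Real.exp (B * T.card) :=
    fun T => hPM β hβ L n q x R hq hR hRa hRL hsep T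
  have key := abs_integral_prod_sub_mean_le_of_productResponse (d := 4) r.ρ r.continuous β (L := 2 * L + 1)
      (n := n)
      (fun i => cubeEdges (fun k => x i k - (R + 1)) (2 * R + 3))
      (fun i => cubeEdges (fun k => x i k - (R + 1)) (2 * R + 3))
      (fun i U => plane G r (q i) (x i) U - p (q i) β) hAc hAb hAS hinj hfar
      (fun i => torusE G r β L (plane G r (q i) (x i)) - p (q i) β) hm
      (fun i => Y β R (q i) (x i)) (fun i => hYm β R (q i) (x i)) (fun i η => hY0 β R (q i) (x i) η)
      (MY := MY β R) (fun i η => hYb β R (q i) (x i) η)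
      (p := 0) (ε := C₁ / (R : ℝ) ^ 4) (B := B) (by positivity) hker hpm
  simp only [sub_sub_sub_cancel_right] at key
  refine key.trans (le_of_eq ?_)
  congr 1
  field_simp

/-- **`MomentBounds6 G r a` from (PM) alone — all odd sides.**  Let `p q β` be reference values (`|p| ≤ P₀`), `C₁ > 0`,
`B`, `ℓ₁ > 0`, `β₁`.  (PM): for `β ≥ β₁`, on every odd torus `(ℤ/(2L+1))⁴` with `4R+8 ≤ L`, `1 ≤ R`, `R·a β ≤ ℓ₁`, for
orientations `(q i).1 < (q i).2`, sites pairwise cyclically `2R+4`-separated in some coordinate, and every index set `T`,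
`⟨∏_{i∈T} (1 + (R⁴/C₁)·|kerE_{x i − (R+1), 2R+3}(plane (q i) (x i))(lift U) − p (q i) β|)⟩_{2L+1,β} ≤ exp(B·#T)`.
THEN `MomentBounds6 G r a` with `C = C₁ (2 + e^B) e^B`, `β₄ = β₁`, `ℓ₄ = ℓ₁`: §2's engine with the carrier
`Y := (R⁴/C₁)|kerE(plane)(η) − p|`, for which the response law is an identity (the (PM) twin of p532025).  At `T = {i}`
(PM) is a FIRST-moment condition only. [folklore: Georgii (2011) Thm. 4.17 for the DLR part] -/
theorem momentBounds6_of_productMoments {C₁ B β₁ ℓ₁ P₀ : ℝ} {p : Fin 4 × Fin 4 → ℝ → ℝ}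
    (hℓ₁ : 0 < ℓ₁) (hC₁ : 0 < C₁) (hp : ∀ q β, |p q β| ≤ P₀)
    (hPM : ∀ β : ℝ, β₁ ≤ β → ∀ (L n : ℕ) (q : Fin n → Fin 4 × Fin 4) (x : Fin n → (Fin 4 → ℤ)) (R : ℕ),
      (∀ i, (q i).1 < (q i).2) → 1 ≤ R → (R : ℝ) * a β ≤ ℓ₁ → 4 * R + 8 ≤ L →
      (∀ i j : Fin n, i ≠ j → ∃ k : Fin 4,
        (2 * (R : ℤ) + 4) ≤ |((((x i k - x j k : ℤ) : ZMod (2 * L + 1))).valMinAbs : ℤ)|) →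
      ∀ T : Finset (Fin n),
        torusE G r β L (fun U => ∏ i ∈ T, (1 + (R : ℝ) ^ 4 / C₁ *
          |kerE G r β (fun k => x i k - (R + 1)) (2 * R + 3) U (plane G r (q i) (x i)) - p (q i) β|)) ≤
          Real.exp (B * T.card)) :
    MomentBounds6 G r a := by
  haveI : SecondCountableTopology G :=
    (r.continuous.isClosedEmbedding r.injective).isEmbedding.secondCountableTopology
  obtain ⟨CA, hCA⟩ := exists_abs_plane_le r
  have hP₀ : 0 ≤ P₀ := (abs_nonneg _).trans (hp (0, 1) 0)
  refine momentBounds6_of_productResponse r a (C₁ := C₁) (B := B) (β₁ := β₁) (ℓ₁ := ℓ₁) (P₀ := P₀) (p := p)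
    (fun β R q x η => (R : ℝ) ^ 4 / C₁ *
      |kerE G r β (fun k => x k - (R + 1)) (2 * R + 3) η (plane G r q x) - p q β|)
    (fun β R => (R : ℝ) ^ 4 / C₁ * (CA + P₀)) hℓ₁ hC₁.le hp ?_ ?_ ?_ ?_ hPM
  · intro β R q x
    exact (((continuous_kerE_plane r β _ _ q x).sub continuous_const).abs.const_mul _).measurable
  · intro β R q x η
    positivity
  · intro β R q x η
    refine mul_le_mul_of_nonneg_left ?_ (by positivity)
    exact (abs_sub _ _).trans (add_le_add (abs_kerE_plane_le r β _ _ q x hCA η) (hp q β))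
  · intro β hβ R hR hRa q x hq η
    have hR4 : (0 : ℝ) < (R : ℝ) ^ 4 := by positivity
    have hid : C₁ / (R : ℝ) ^ 4 * (1 + (R : ℝ) ^ 4 / C₁ *
        |kerE G r β (fun k => x k - (R + 1)) (2 * R + 3) η (plane G r q x) - p q β|) =
        C₁ / (R : ℝ) ^ 4 + |kerE G r β (fun k => x k - (R + 1)) (2 * R + 3) η (plane G r q x) - p q β| := by
      field_simp
    rw [hid]
    linarith [div_nonneg hC₁.le hR4.le]

end Route

end Summit.QuantumFields.YangMills.Cruxes.UVSeamRec.ProductMoments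

end
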